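import Summits.MatrixMultiplication.MatrixMultiplication.Theorems.SoloBlindGeneralKills

/-!
# (K₃) and Conjecture E reduce to the two-sided proper presence families

Sub-programme (K₃) / Conjecture E (K3.31–K3.32).  `S = B ∪ X`, `B` sum-distinct, `G` of exponent `3`.  For a
target `τ` call `C ⊆ X` PRESENT if `τ - ∑_{x ∈ C} h x` is `B`-representable; the presence family of `τ` over `X`
is TWO-SIDED PROPER if some `C ⊆ X` is absent and, for every `x ∈ X`, some present `C` contains `x` and some
present `C` omits `x`.

* `soloBlind_kraft_reduction` — if `K(τ'; B ∪ X') ≤ 1` whenever `X' ⊆ X` and the presence family of `τ'` over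
  `X'` is two-sided proper, then `K(τ; B ∪ X) ≤ 1` for every `τ` ((K₃) at corank `|X|`).
* `soloBlind_conjE_reduction` — the same for Conjecture E (with the (K₃)-handler for all `τ'` and the E-handler
  for the given H-good `τ`).

Proof: strong induction on `X`; all-present ⟹ `soloBlind_kraft_allPresent` / `soloBlind_conjE_allPresent`;
one-sided in some `x` ⟹ `soloBlind_kraft_presence_step` / `soloBlind_conjE_presence_step` and the induction
hypothesis for `X \ {x}`; otherwise the family is two-sided proper and the handler applies.  So in every corank the
open content of (K₃)/E is the finite list of two-sided proper families (`5` at corank two, `59` at corank three up to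
symmetry, K3.32).
-/

namespace Summit.MatrixMultiplication.MatrixMultiplication.Theorems

open Finset

universe u

variable {ι : Type*} [DecidableEq ι]
variable {G : Type u} [AddCommGroup G] [DecidableEq G]

/-- `C` is PRESENT for `τ` over `B`: the shifted target `τ - ∑_{i ∈ C} h i` has a `B`-representation. -/
def soloBlindPresent (h : ι → G) (B : Finset ι) (τ : G) (C : Finset ι) : Prop :=
  (soloBlindSeqRepAll h B (τ - ∑ i ∈ C, h i)).Nonempty

/-- The presence family of `τ` over the outside indices `X` is TWO-SIDED PROPER: some `C ⊆ X` is absent, and every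
`x ∈ X` lies in some present `C` and outside some present `C`. -/
def soloBlindTwoSidedProper (h : ι → G) (B X : Finset ι) (τ : G) : Prop :=
  (∃ C ⊆ X, ¬ soloBlindPresent h B τ C) ∧
    ∀ x ∈ X, (∃ C ⊆ X, x ∈ C ∧ soloBlindPresent h B τ C) ∧ (∃ C ⊆ X, x ∉ C ∧ soloBlindPresent h B τ C)

/-- One-sidedness in `x` in the format of `soloBlind_kraft_presence_step`. -/
theorem soloBlind_absent_format (h : ι → G) (B X : Finset ι) (τ : G) {x : ι} (hx : x ∈ X)
    (hside : (∀ C ⊆ X, x ∈ C → ¬ soloBlindPresent h B τ C) ∨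
      (∀ C ⊆ X, x ∉ C → ¬ soloBlindPresent h B τ C)) :
    (∀ C ⊆ X.erase x, soloBlindSeqRepAll h B (τ - h x - ∑ i ∈ C, h i) = ∅) ∨
      (∀ C ⊆ X.erase x, soloBlindSeqRepAll h B (τ - ∑ i ∈ C, h i) = ∅) := by
  rcases hside with hs | hs
  · left
    intro C hC
    have hxC : x ∉ C := fun h' => Finset.notMem_erase x X (hC h')
    have hCX : insert x C ⊆ X := Finset.insert_subset hx (hC.trans (Finset.erase_subset x X))
    have np := hs (insert x C) hCX (Finset.mem_insert_self x C)
    unfold soloBlindPresent at np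
    rw [Finset.sum_insert hxC, ← sub_sub] at np
    exact Finset.not_nonempty_iff_eq_empty.mp np
  · right
    intro C hC
    have hxC : x ∉ C := fun h' => Finset.notMem_erase x X (hC h')
    exact Finset.not_nonempty_iff_eq_empty.mp (hs C (hC.trans (Finset.erase_subset x X)) hxC)

/-- (K₃) REDUCES TO THE TWO-SIDED PROPER FAMILIES (every corank, exponent `3`, `B` sum-distinct). -/
theorem soloBlind_kraft_reduction (three : ∀ g : G, g + g + g = 0) {h : ι → G} {B : Finset ι}
    (hdist : ∀ A ⊆ B, ∀ A' ⊆ B, ∑ i ∈ A, h i = ∑ i ∈ A', h i → A = A') (X : Finset ι)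
    (hd : Disjoint B X) (zsf : ∀ T ⊆ B ∪ X, T.Nonempty → ∑ i ∈ T, h i ≠ 0)
    (handler : ∀ X' ⊆ X, ∀ τ', soloBlindTwoSidedProper h B X' τ' → soloBlindMass h (B ∪ X') τ' ≤ 1)
    (τ : G) : soloBlindMass h (B ∪ X) τ ≤ 1 := by
  induction X using Finset.strongInduction generalizing τ with
  | H X ih =>
    by_cases hall : ∀ C ⊆ X, soloBlindPresent h B τ C
    · have hex : ∀ C, C ⊆ X → ∃ A, A ∈ soloBlindSeqRepAll h B (τ - ∑ i ∈ C, h i) :=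
        fun C hC => hall C hC
      choose! A hA using hex
      exact soloBlind_kraft_allPresent three hd hdist zsf hA
    · push Not at hall
      by_cases hone : ∃ x ∈ X, (∀ C ⊆ X, x ∈ C → ¬ soloBlindPresent h B τ C) ∨
          (∀ C ⊆ X, x ∉ C → ¬ soloBlindPresent h B τ C)
      · obtain ⟨x, hx, hside⟩ := hone
        have hXX : X.erase x ⊆ X := Finset.erase_subset x X
        have IH : ∀ τ', soloBlindMass h (B ∪ X.erase x) τ' ≤ 1 := fun τ' =>
          ih (X.erase x) (Finset.erase_ssubset hx) (Finset.disjoint_of_subset_right hXX hd)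
            (fun T hT hTne => zsf T (hT.trans (Finset.union_subset_union subset_rfl hXX)) hTne)
            (fun X' hX' τ'' hts => handler X' (hX'.trans hXX) τ'' hts) τ'
        exact soloBlind_kraft_presence_step h hd hx IH (soloBlind_absent_format h B X τ hx hside)
      · push Not at hone
        exact handler X subset_rfl τ ⟨hall, hone⟩

/-- CONJECTURE E REDUCES TO THE TWO-SIDED PROPER FAMILIES (every corank, exponent `3`, `B` sum-distinct): given the
(K₃)-handler for all targets and the E-handler for the H-good target `τ`. -/
theorem soloBlind_conjE_reduction (three : ∀ g : G, g + g + g = 0) {h : ι → G} {B : Finset ι}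
    (hdist : ∀ A ⊆ B, ∀ A' ⊆ B, ∑ i ∈ A, h i = ∑ i ∈ A', h i → A = A') (X : Finset ι)
    (hd : Disjoint B X) (zsf : ∀ T ⊆ B ∪ X, T.Nonempty → ∑ i ∈ T, h i ≠ 0) {τ : G}
    (hgood : ∀ T ⊆ B ∪ X, ∑ i ∈ T, h i ≠ τ + τ)
    (handlerK : ∀ X' ⊆ X, ∀ τ', soloBlindTwoSidedProper h B X' τ' → soloBlindMass h (B ∪ X') τ' ≤ 1)
    (handlerE : ∀ X' ⊆ X, soloBlindTwoSidedProper h B X' τ → soloBlindMass h (B ∪ X') τ ≤ 1 / 2) :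
    soloBlindMass h (B ∪ X) τ ≤ 1 / 2 := by
  induction X using Finset.strongInduction with
  | H X ih =>
    by_cases hall : ∀ C ⊆ X, soloBlindPresent h B τ C
    · have hex : ∀ C, C ⊆ X → ∃ A, A ∈ soloBlindSeqRepAll h B (τ - ∑ i ∈ C, h i) :=
        fun C hC => hall C hC
      choose! A hA using hex
      exact soloBlind_conjE_allPresent three hd hdist zsf hgood hA
    · push Not at hall
      by_cases hone : ∃ x ∈ X, (∀ C ⊆ X, x ∈ C → ¬ soloBlindPresent h B τ C) ∨
          (∀ C ⊆ X, x ∉ C → ¬ soloBlindPresent h B τ C)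
      · obtain ⟨x, hx, hside⟩ := hone
        have hXX : X.erase x ⊆ X := Finset.erase_subset x X
        have hd' : Disjoint B (X.erase x) := Finset.disjoint_of_subset_right hXX hd
        have zsf' : ∀ T ⊆ B ∪ X.erase x, T.Nonempty → ∑ i ∈ T, h i ≠ 0 :=
          fun T hT hTne => zsf T (hT.trans (Finset.union_subset_union subset_rfl hXX)) hTne
        have IHK : ∀ τ', soloBlindMass h (B ∪ X.erase x) τ' ≤ 1 := fun τ' =>
          soloBlind_kraft_reduction three hdist (X.erase x) hd' zsf'
            (fun X' hX' τ'' hts => handlerK X' (hX'.trans hXX) τ'' hts) τ'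
        have IHE : soloBlindMass h (B ∪ X.erase x) τ ≤ 1 / 2 :=
          ih (X.erase x) (Finset.erase_ssubset hx) hd' zsf'
            (fun T hT => hgood T (hT.trans (Finset.union_subset_union subset_rfl hXX)))
            (fun X' hX' τ'' hts => handlerK X' (hX'.trans hXX) τ'' hts)
            (fun X' hX' hts => handlerE X' (hX'.trans hXX) hts)
        exact soloBlind_conjE_presence_step h hd hx IHK IHE (soloBlind_absent_format h B X τ hx hside)
      · push Not at hone
        exact handlerE X subset_rfl ⟨hall, hone⟩

end Summit.MatrixMultiplication.MatrixMultiplication.Theorems
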